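import Summits.RiemannHypothesis.RiemannHypothesis.Theorems.WeilTwoPrimeDeflM80XBase
import Summits.RiemannHypothesis.RiemannHypothesis.Theorems.WeilTwoPrimeDeflM80XDataPE10
import Literature.NumberTheory.LFunctions.WeilBlockRowsPZ
import Literature.NumberTheory.LFunctions.WeilBlockRowsFast
import Summits.RiemannHypothesis.RiemannHypothesis.Theorems.WeilTwoPrimeDeflM80PDataDnE18
import HarnessLib

/-!
# Calibration certificate M80X: dominance of rows 30–34 of `R = S''_even(κ') − UᵀU` (factored data, fast rows)

`WeilCert.checkDomRowF` + `checkDomRowPZ_of_F` with the materialized augmented block, M80P's factored inverse `weilCertDeflM80XDnE/weilCertDeflM80PLsE` and the Bessel block, by `decide +kernel` row by row. Pure proof file.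
-/

set_option linter.dupNamespace false

noncomputable section

namespace Summit.RiemannHypothesis.RiemannHypothesis.Theorems.EvenWinsBeyondArch

open Literature.NumberTheory.LFunctions

set_option maxHeartbeats 0 in
/-- Kernel check of the dominance of row 30 of `R` in the fast form `checkDomRowF` (even block, certificate M80X). [folklore] -/
theorem checkDomRowF0_30_weilCertDeflM80X :
    weilCertDeflM80XBase.checkDomRowF weilCertDeflM80XPmE weilCertDeflM80XDnE weilCertDeflM80PLsE weilCertDeflM80XHpE weilCertDeflM80XKappa' 0 30 = true := by
  decide +kernel

/-- Kernel check of the dominance of row 30 of `R` (even block, certificate M80X), from the fast row. [folklore] -/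
theorem checkDomRowPZ0_30_weilCertDeflM80X :
    weilCertDeflM80XBase.checkDomRowPZ weilCertDeflM80XPmE weilCertDeflM80XDnE weilCertDeflM80PLsE weilCertDeflM80XHpE weilCertDeflM80XKappa' 0 30 = true :=
  WeilCert.checkDomRowPZ_of_F (by decide) checkDomRowF0_30_weilCertDeflM80X

set_option maxHeartbeats 0 in
/-- Kernel check of the dominance of row 31 of `R` in the fast form `checkDomRowF` (even block, certificate M80X). [folklore] -/
theorem checkDomRowF0_31_weilCertDeflM80X :
    weilCertDeflM80XBase.checkDomRowF weilCertDeflM80XPmE weilCertDeflM80XDnE weilCertDeflM80PLsE weilCertDeflM80XHpE weilCertDeflM80XKappa' 0 31 = true := by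
  decide +kernel

/-- Kernel check of the dominance of row 31 of `R` (even block, certificate M80X), from the fast row. [folklore] -/
theorem checkDomRowPZ0_31_weilCertDeflM80X :
    weilCertDeflM80XBase.checkDomRowPZ weilCertDeflM80XPmE weilCertDeflM80XDnE weilCertDeflM80PLsE weilCertDeflM80XHpE weilCertDeflM80XKappa' 0 31 = true :=
  WeilCert.checkDomRowPZ_of_F (by decide) checkDomRowF0_31_weilCertDeflM80X

set_option maxHeartbeats 0 in
/-- Kernel check of the dominance of row 32 of `R` in the fast form `checkDomRowF` (even block, certificate M80X). [folklore] -/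
theorem checkDomRowF0_32_weilCertDeflM80X :
    weilCertDeflM80XBase.checkDomRowF weilCertDeflM80XPmE weilCertDeflM80XDnE weilCertDeflM80PLsE weilCertDeflM80XHpE weilCertDeflM80XKappa' 0 32 = true := by
  decide +kernel

/-- Kernel check of the dominance of row 32 of `R` (even block, certificate M80X), from the fast row. [folklore] -/
theorem checkDomRowPZ0_32_weilCertDeflM80X :
    weilCertDeflM80XBase.checkDomRowPZ weilCertDeflM80XPmE weilCertDeflM80XDnE weilCertDeflM80PLsE weilCertDeflM80XHpE weilCertDeflM80XKappa' 0 32 = true :=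
  WeilCert.checkDomRowPZ_of_F (by decide) checkDomRowF0_32_weilCertDeflM80X

set_option maxHeartbeats 0 in
/-- Kernel check of the dominance of row 33 of `R` in the fast form `checkDomRowF` (even block, certificate M80X). [folklore] -/
theorem checkDomRowF0_33_weilCertDeflM80X :
    weilCertDeflM80XBase.checkDomRowF weilCertDeflM80XPmE weilCertDeflM80XDnE weilCertDeflM80PLsE weilCertDeflM80XHpE weilCertDeflM80XKappa' 0 33 = true := by
  decide +kernel

/-- Kernel check of the dominance of row 33 of `R` (even block, certificate M80X), from the fast row. [folklore] -/
theorem checkDomRowPZ0_33_weilCertDeflM80X :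
    weilCertDeflM80XBase.checkDomRowPZ weilCertDeflM80XPmE weilCertDeflM80XDnE weilCertDeflM80PLsE weilCertDeflM80XHpE weilCertDeflM80XKappa' 0 33 = true :=
  WeilCert.checkDomRowPZ_of_F (by decide) checkDomRowF0_33_weilCertDeflM80X

set_option maxHeartbeats 0 in
/-- Kernel check of the dominance of row 34 of `R` in the fast form `checkDomRowF` (even block, certificate M80X). [folklore] -/
theorem checkDomRowF0_34_weilCertDeflM80X :
    weilCertDeflM80XBase.checkDomRowF weilCertDeflM80XPmE weilCertDeflM80XDnE weilCertDeflM80PLsE weilCertDeflM80XHpE weilCertDeflM80XKappa' 0 34 = true := by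
  decide +kernel

/-- Kernel check of the dominance of row 34 of `R` (even block, certificate M80X), from the fast row. [folklore] -/
theorem checkDomRowPZ0_34_weilCertDeflM80X :
    weilCertDeflM80XBase.checkDomRowPZ weilCertDeflM80XPmE weilCertDeflM80XDnE weilCertDeflM80PLsE weilCertDeflM80XHpE weilCertDeflM80XKappa' 0 34 = true :=
  WeilCert.checkDomRowPZ_of_F (by decide) checkDomRowF0_34_weilCertDeflM80X

end Summit.RiemannHypothesis.RiemannHypothesis.Theorems.EvenWinsBeyondArch

end
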